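import Literature.MathematicalPhysics.QuantumLattice.TorusWilsonMarkov
import Literature.MathematicalPhysics.QuantumLattice.WilsonBlockHeatBathSemigroup
import Literature.MathematicalPhysics.QuantumLattice.WilsonBlockHeatBathMarkov3

/-!
# Kernel versions for the cyclic peeling (crux `ConvexGribovBody.PoincareToGap`, line `Sketch`, stub P1)

For the torus Wilson state `μ = wilsonMeasure r.ρ β` on `GaugeConfig 4 (2S+1) G`, an arc of time slices of
length `ℓ` from time `s` (`1 ≤ ℓ ≤ 2S`; the links `e` with `(e.1 0 - s).val < ℓ`) and a bounded measurable
gauge-invariant `f` reading only links based in the arc, the conditional expectation of `f` given the links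
based OUTSIDE the arc has a version which is measurable, bounded by the same constant, gauge-invariant
everywhere, and reads only the SPATIAL links of the two outer boundary slices (offsets `ℓ` and `2S` from `s`).

Proof.  (1) The DLR kernel of the plaquette specification is a local version
(`WilsonBlockHeatBath.exists_local_condExp_version`): a plaquette meeting the arc has all its links in the
arc or in `T` := (all links at offset `2S`) ∪ (spatial links at offset `ℓ`), because Wilson plaquettes span
at most two consecutive time slices.  (2) Averaging over the compact gauge group (Haar probability on
`G^{sites}`, Fubini) turns the local version — which is a.e. invariant under every gauge transformation, by
the gauge covariance of conditional expectations `WilsonBlockHeatBath.condExp_linkSigma_comp_gaugeTransform`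
and the gauge invariance of `f` and of `μ` — into an everywhere gauge-invariant version, still reading only
`T` (gauge transformations act link by link).  (3) An everywhere gauge-invariant function reading only `T`
does not read the temporal links at offset `2S`: the gauge transformation supported on the time-`s` sites,
`k x = V(x - e₀, 0)⁻¹ U(x - e₀, 0)`, moves `U` to a configuration agreeing with `V` on `T` as soon as `U`
and `V` agree on the spatial part of `T`.

References: F. Martinelli, LNM 1717 (1999), §3 (block heat-bath kernels of finite-range specifications);
E. Seiler, LNP 159 (1982), §1 (gauge transformations); H.-O. Georgii, *Gibbs Measures and Phase
Transitions* (2011), Rem. 1.24.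
-/

noncomputable section

open scoped BigOperators Topology
open MeasureTheory ProbabilityTheory Filter
open Literature.MathematicalPhysics.QuantumFieldTheory Literature.MathematicalPhysics.QuantumLattice

namespace Summit.QuantumFields.YangMills.Theorems.PoincareToGap

/-! ### Arithmetic of time offsets on the ring `ℤ/(2S+1)` -/

/-- If a plaquette based at offset `τ` (links at offsets `τ` and `(τ+1) mod (2S+1)`) meets the arc
`{offset < ℓ}` (`ℓ + 1 ≤ 2S + 1`), then its base offset is in the arc or equals `2S`. -/
private theorem lt_or_eq_of_meets_arc {τ ℓ S : ℕ} (hτ : τ < 2 * S + 1)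
    (h0 : τ < ℓ ∨ (τ + 1) % (2 * S + 1) < ℓ) : τ < ℓ ∨ τ = 2 * S := by
  rcases h0 with h | h
  · exact Or.inl h
  · rcases Nat.lt_or_ge (τ + 1) (2 * S + 1) with h1 | h1
    · rw [Nat.mod_eq_of_lt h1] at h
      left; omega
    · right; omega

/-- If a plaquette based at offset `τ` meets the arc `{offset < ℓ}` (`ℓ + 1 ≤ 2S + 1`), then its upper
offset `(τ+1) mod (2S+1)` is in the arc or equals `ℓ`. -/
private theorem succ_mod_lt_or_eq_of_meets_arc {τ ℓ S : ℕ} (hℓS : ℓ + 1 ≤ 2 * S + 1)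
    (h0 : τ < ℓ ∨ (τ + 1) % (2 * S + 1) < ℓ) :
    (τ + 1) % (2 * S + 1) < ℓ ∨ (τ + 1) % (2 * S + 1) = ℓ := by
  rcases h0 with h | h
  · have h1 : τ + 1 < 2 * S + 1 := by omega
    rw [Nat.mod_eq_of_lt h1]
    omega
  · exact Or.inl h

/-- A spatial shift does not change the time coordinate. -/
private theorem shift_apply_zero_of_ne {N : ℕ} (y : Site 4 N) {j : Fin 4} (hj : j ≠ 0) :
    (y.shift j) 0 = y 0 := by
  simp only [Site.shift, Pi.add_apply, Pi.single_eq_of_ne' hj, add_zero]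

/-! ### Gauge averaging keeping locality -/

/-- **Invariant local versions by averaging over the compact gauge group**: a bounded measurable function `h`
of the links, reading only the links in `T`, with `h ∘ (·)^g = h` `μ`-a.e. for every gauge transformation `g`
(any s-finite `μ`) is `μ`-a.e. equal to the bounded measurable, everywhere gauge-invariant function
`U ↦ ∫ h(U^{g⁻¹}) dg` (Haar probability on `G^{sites}`), which still reads only the links in `T` because gauge
transformations act link by link. -/
private theorem exists_isGaugeInvariant_local_version {G : Type} [Group G] [TopologicalSpace G]
    [IsTopologicalGroup G] [CompactSpace G] [MeasurableSpace G] [BorelSpace G]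
    [SecondCountableTopology G] {N : ℕ} [NeZero N] (μ : Measure (GaugeConfig 4 N G)) [SFinite μ]
    {h : GaugeConfig 4 N G → ℝ} (hm : Measurable h) {B : ℝ} (hB : ∀ U, |h U| ≤ B)
    {T : Set (Edge 4 N)} (hT : DependsOn h T)
    (hinv : ∀ g : Site 4 N → G, h ∘ gaugeTransform g =ᵐ[μ] h) :
    ∃ h' : GaugeConfig 4 N G → ℝ, Measurable h' ∧ (∀ U, |h' U| ≤ B) ∧ IsGaugeInvariant h' ∧
      DependsOn h' T ∧ h' =ᵐ[μ] h := by
  -- adapted from Literature/MathematicalPhysics/QuantumLattice/WilsonBlockHeatBathMarkov3.lean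
  -- (`WilsonBlockHeatBath.exists_isGaugeInvariant_version`), recording in addition the locality of the average
  set ν : Measure (Site 4 N → G) := Measure.pi fun _ => haarProbability G
  -- joint measurability of the action
  have hΦ : Measurable fun q : (Site 4 N → G) × GaugeConfig 4 N G => gaugeTransform q.1⁻¹ q.2 := by
    refine measurable_pi_lambda _ fun e => ?_
    simp only [gaugeTransform, Pi.inv_apply, inv_inv]
    exact ((((measurable_pi_apply e.1).comp measurable_fst).inv).mul
      ((measurable_pi_apply e).comp measurable_snd)).mul ((measurable_pi_apply _).comp measurable_fst)
  have hjoint : Measurable fun q : (Site 4 N → G) × GaugeConfig 4 N G => h (gaugeTransform q.1⁻¹ q.2) :=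
    hm.comp hΦ
  refine ⟨fun U => ∫ g, h (gaugeTransform g⁻¹ U) ∂ν,
    (hjoint.stronglyMeasurable.integral_prod_left' (μ := ν)).measurable, fun U => ?_, fun g' U => ?_,
    fun U V hUV => ?_, ?_⟩
  · -- bound
    have := norm_integral_le_of_norm_le_const (μ := ν) (f := fun g => h (gaugeTransform g⁻¹ U)) (C := B)
      (ae_of_all _ fun g => by rw [Real.norm_eq_abs]; exact hB _)
    rwa [Real.norm_eq_abs, probReal_univ, mul_one] at this
  · -- invariance: left invariance of the Haar measure of `G^{sites}`
    have hrw : ∀ g : Site 4 N → G, h (gaugeTransform g⁻¹ (gaugeTransform g' U)) =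
        (fun k : Site 4 N → G => h (gaugeTransform k⁻¹ U)) (g'⁻¹ * g) := fun g => by
      simp only [WilsonBlockHeatBath.gaugeTransform_gaugeTransform, mul_inv_rev, inv_inv]
    simp_rw [hrw]
    exact integral_mul_left_eq_self (fun k : Site 4 N → G => h (gaugeTransform k⁻¹ U)) g'⁻¹
  · -- locality: gauge transformations act link by link
    show ∫ g, h (gaugeTransform g⁻¹ U) ∂ν = ∫ g, h (gaugeTransform g⁻¹ V) ∂ν
    refine integral_congr_ae (ae_of_all _ fun g => hT fun e he => ?_)
    simp only [gaugeTransform, hUV e he]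
  · -- a.e. equality: Fubini
    have H1 : ∀ᵐ g ∂ν, ∀ᵐ U ∂μ, h (gaugeTransform g⁻¹ U) = h U :=
      ae_of_all _ fun g => hinv g⁻¹
    have hmeas : MeasurableSet
        {q : (Site 4 N → G) × GaugeConfig 4 N G | h (gaugeTransform q.1⁻¹ q.2) = h q.2} :=
      measurableSet_eq_fun hjoint (hm.comp measurable_snd)
    have H2 : ∀ᵐ U ∂μ, ∀ᵐ g ∂ν, h (gaugeTransform g⁻¹ U) = h U := (Measure.ae_ae_comm hmeas).1 H1
    filter_upwards [H2] with U hU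
    rw [integral_congr_ae hU, integral_const, probReal_univ, one_smul]

/-! ### Gauge invariance removes the temporal links of the lower boundary slice -/

/-- An everywhere gauge-invariant function of the links of the torus `(2S+1)⁴` reading only the links at time
offset `2S` from `s` and the spatial links at offset `ℓ` (`1 ≤ ℓ ≤ 2S`) reads only the SPATIAL links at the
offsets `ℓ` and `2S`: the gauge transformation `k x = V(x - e₀, 0)⁻¹ U(x - e₀, 0)` on the time-`s` sites
(`k = 1` elsewhere) fixes every link not touching the time-`s` sites and moves the temporal links based at
time `s - 1` of `U` to those of `V`. -/
private theorem dependsOn_spatial_of_isGaugeInvariant {G : Type} [Group G] {S : ℕ}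
    (s : ZMod (2 * S + 1)) {ℓ : ℕ} (hℓ : 1 ≤ ℓ) (hℓS : ℓ + 1 ≤ 2 * S + 1)
    {F : GaugeConfig 4 (2 * S + 1) G → ℝ} (hGI : IsGaugeInvariant F)
    (hF : DependsOn F {e : Edge 4 (2 * S + 1) |
      (e.1 0 - s).val = 2 * S ∨ ((e.1 0 - s).val = ℓ ∧ e.2 ≠ 0)}) :
    DependsOn F {e : Edge 4 (2 * S + 1) |
      ((e.1 0 - s).val = ℓ ∨ (e.1 0 - s).val = 2 * S) ∧ e.2 ≠ 0} := by
  intro U V hUV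
  change GaugeConfig 4 (2 * S + 1) G at U V
  -- the gauge transformation supported on the time-`s` sites
  obtain ⟨k, hk⟩ : ∃ k : Site 4 (2 * S + 1) → G, ∀ x, k x =
      if x 0 = s then (V (x - Pi.single 0 1, 0))⁻¹ * U (x - Pi.single 0 1, 0) else 1 :=
    ⟨_, fun x => rfl⟩
  -- sites at the offsets `ℓ`, `2S` are not at time `s`
  have hne : ∀ y : Site 4 (2 * S + 1), ((y 0 - s).val = ℓ ∨ (y 0 - s).val = 2 * S) → y 0 ≠ s := by
    intro y hy h
    rw [h, sub_self, ZMod.val_zero] at hy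
    omega
  -- on spatial links at the offsets `ℓ`, `2S` the transformation is trivial
  have hfix : ∀ (y : Site 4 (2 * S + 1)) (j : Fin 4),
      ((y 0 - s).val = ℓ ∨ (y 0 - s).val = 2 * S) → j ≠ 0 → gaugeTransform k U (y, j) = U (y, j) := by
    intro y j hy hj
    have h1 : y 0 ≠ s := hne y hy
    have h3 : (y.shift j) 0 ≠ s := by rw [shift_apply_zero_of_ne y hj]; exact h1
    simp only [gaugeTransform, hk, h1, h3, if_false, one_mul, inv_one, mul_one]
  -- on the temporal links at offset `2S` it produces `V`
  have htemp : ∀ y : Site 4 (2 * S + 1), (y 0 - s).val = 2 * S →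
      gaugeTransform k U (y, 0) = V (y, 0) := by
    intro y hy
    have h1 : y 0 ≠ s := hne y (Or.inr hy)
    have h2 : (y.shift 0) 0 = s := by
      have hc : (((y 0 - s).val : ℕ) : ZMod (2 * S + 1)) = y 0 - s := ZMod.natCast_zmod_val _
      rw [hy] at hc
      have hN : ((2 * S + 1 : ℕ) : ZMod (2 * S + 1)) = 0 := ZMod.natCast_self _
      simp only [Site.shift, Pi.add_apply, Pi.single_eq_same]
      push_cast at hc hN
      linear_combination hN - hc
    have hk1 : k y = 1 := by rw [hk, if_neg h1]
    have hk2 : k (y.shift 0) = (V (y, 0))⁻¹ * U (y, 0) := by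
      rw [hk, if_pos h2]
      simp only [Site.shift, add_sub_cancel_right]
    simp only [gaugeTransform, hk1, hk2, one_mul, mul_inv_rev, inv_inv]
    exact mul_inv_cancel_left _ _
  -- hence `U^k` agrees with `V` on the whole of `T`
  have hagree : ∀ e ∈ {e : Edge 4 (2 * S + 1) |
      (e.1 0 - s).val = 2 * S ∨ ((e.1 0 - s).val = ℓ ∧ e.2 ≠ 0)}, gaugeTransform k U e = V e := by
    rintro ⟨y, j⟩ he
    rcases he with he | ⟨he, hj⟩
    · by_cases hj : j = 0
      · subst hj
        exact htemp y he
      · rw [hfix y j (Or.inr he) hj]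
        exact hUV (y, j) ⟨Or.inr he, hj⟩
    · rw [hfix y j (Or.inl he) hj]
      exact hUV (y, j) ⟨Or.inl he, hj⟩
  calc F U = F (gaugeTransform k U) := (hGI k U).symm
    _ = F V := hF hagree

/-! ### The stub -/

/-- `stub_kernelVersion` — **local gauge-invariant version of the heat-bath average over a time arc** (P1 of the
line `Sketch`, cyclic peeling).  For the torus Wilson state `μ`, an arc of slices of length `ℓ` from time `s`
(`1 ≤ ℓ ≤ 2S`) and a bounded measurable gauge-invariant `f` reading only links based in the arc, the
conditional expectation of `f` given the links based OUTSIDE the arc has a version which is measurable, bounded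
by the same constant, gauge-invariant everywhere, and reads only the SPATIAL links of the two outer boundary
slices (offsets `ℓ` and `2S` from `s`).  Proof: the DLR kernel of the plaquette potential is a local version
(`WilsonBlockHeatBath.exists_local_condExp_version` with `T` = slice `s−1` ∪ spatial part of slice `s+ℓ`:
a plaquette meeting the arc lies in the arc ∪ `T`); average it over the compact gauge group keeping the
locality (`exists_isGaugeInvariant_local_version`, fed by `condExp_linkSigma_comp_gaugeTransform` and the gauge
invariance of `f`); finally an everywhere gauge-invariant function reading only `T` does not read the temporal
links of slice `s−1` (`dependsOn_spatial_of_isGaugeInvariant`). -/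
theorem stub_kernelVersion :
    ∀ (G : Type) [Group G] [TopologicalSpace G] [IsTopologicalGroup G] [CompactSpace G]
      [MeasurableSpace G] [BorelSpace G] (r : LatticeRep G) (β : ℝ) (S : ℕ)
      (μ : Measure (GaugeConfig 4 (2 * S + 1) G)),
      μ = (wilsonMeasure r.ρ β : Measure (GaugeConfig 4 (2 * S + 1) G)) →
    ∀ (s : ZMod (2 * S + 1)) (ℓ : ℕ), 1 ≤ ℓ → ℓ + 1 ≤ 2 * S + 1 →
    ∀ (f : GaugeConfig 4 (2 * S + 1) G → ℝ) (M : ℝ), Measurable f → (∀ U, |f U| ≤ M) →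
      IsGaugeInvariant f → DependsOn f {e : Edge 4 (2 * S + 1) | (e.1 0 - s).val < ℓ} →
    ∃ F : GaugeConfig 4 (2 * S + 1) G → ℝ, Measurable F ∧ (∀ U, |F U| ≤ M) ∧ IsGaugeInvariant F ∧
      DependsOn F {e : Edge 4 (2 * S + 1) |
        ((e.1 0 - s).val = ℓ ∨ (e.1 0 - s).val = 2 * S) ∧ e.2 ≠ 0} ∧
      F =ᵐ[μ] condExp (cylinderEvents {e : Edge 4 (2 * S + 1) | ℓ ≤ (e.1 0 - s).val}) μ f := by
  intro G _ _ _ _ _ _ r β S μ hμ s ℓ hℓ hℓS f M hfm hfM hfGI hfdep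
  subst hμ
  haveI : SecondCountableTopology G :=
    (r.continuous.isClosedEmbedding r.injective).isEmbedding.secondCountableTopology
  haveI : T2Space G := (r.continuous.isClosedEmbedding r.injective).isEmbedding.t2Space
  haveI : IsProbabilityMeasure (wilsonMeasure r.ρ β : Measure (GaugeConfig 4 (2 * S + 1) G)) :=
    isProbabilityMeasure_wilsonMeasure (d := 4) (L := 2 * S + 1) r.ρ r.continuous β
  -- the arc as a finite set of links, and its complement
  obtain ⟨Λ, hΛc⟩ : ∃ Λ : Finset (Edge 4 (2 * S + 1)),
      (↑Λ : Set (Edge 4 (2 * S + 1))) = {e | (e.1 0 - s).val < ℓ} :=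
    ⟨_, Set.Finite.coe_toFinset (Set.toFinite _)⟩
  have hmemΛ : ∀ e, e ∈ Λ ↔ (e.1 0 - s).val < ℓ := fun e => by
    rw [← Finset.mem_coe, hΛc, Set.mem_setOf_eq]
  have hΛcompl : (↑Λ : Set (Edge 4 (2 * S + 1)))ᶜ = {e | ℓ ≤ (e.1 0 - s).val} := by
    rw [hΛc]; ext e; simp only [Set.mem_compl_iff, Set.mem_setOf_eq, not_lt]
  -- geometry: a plaquette meeting the arc lies in the arc or in the outer boundary `T`
  have hgeo : ∀ (y : Site 4 (2 * S + 1)) (i j : Fin 4), i < j →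
      (({(y, i), (y.shift i, j), (y.shift j, i), (y, j)} : Finset (Edge 4 (2 * S + 1))) ∩ Λ).Nonempty →
      (↑({(y, i), (y.shift i, j), (y.shift j, i), (y, j)} : Finset (Edge 4 (2 * S + 1))) :
        Set (Edge 4 (2 * S + 1))) ⊆
        ↑Λ ∪ {e : Edge 4 (2 * S + 1) | (e.1 0 - s).val = 2 * S ∨ ((e.1 0 - s).val = ℓ ∧ e.2 ≠ 0)} := by
    intro y i j hij hne e he
    have hj : j ≠ 0 := Fin.pos_iff_ne_zero.1 (lt_of_le_of_lt (Fin.zero_le i) hij)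
    -- every link of the plaquette sits at the base offset, or one above it on a spatial link
    have hbase : ∀ e ∈ ({(y, i), (y.shift i, j), (y.shift j, i), (y, j)} : Finset (Edge 4 (2 * S + 1))),
        (e.1 0 - s).val = (y 0 - s).val ∨
          ((e.1 0 - s).val = ((y 0 - s).val + 1) % (2 * S + 1) ∧ e.2 ≠ 0) := by
      intro e he
      simp only [Finset.mem_insert, Finset.mem_singleton] at he
      rcases he with rfl | rfl | rfl | rfl
      · exact Or.inl rfl
      · rcases val_shift_apply_sub_eq_or y i 0 s with h | h
        · exact Or.inl h
        · exact Or.inr ⟨h, hj⟩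
      · left
        show ((y.shift j) 0 - s).val = (y 0 - s).val
        rw [shift_apply_zero_of_ne y hj]
      · exact Or.inl rfl
    obtain ⟨e₀, he₀⟩ := hne
    rw [Finset.mem_inter, hmemΛ] at he₀
    have h0 : (y 0 - s).val < ℓ ∨ ((y 0 - s).val + 1) % (2 * S + 1) < ℓ := by
      rcases hbase e₀ he₀.1 with h | ⟨h, -⟩
      · exact Or.inl (h.symm.trans_lt he₀.2)
      · exact Or.inr (h.symm.trans_lt he₀.2)
    have hτ : (y 0 - s).val < 2 * S + 1 := ZMod.val_lt _
    simp only [Set.mem_union, Finset.mem_coe, hmemΛ, Set.mem_setOf_eq]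
    rcases hbase e he with h | ⟨h, h2⟩
    · rcases lt_or_eq_of_meets_arc hτ h0 with h' | h'
      · exact Or.inl (h.trans_lt h')
      · exact Or.inr (Or.inl (h.trans h'))
    · rcases succ_mod_lt_or_eq_of_meets_arc hℓS h0 with h' | h'
      · exact Or.inl (h.trans_lt h')
      · exact Or.inr (Or.inr ⟨h.trans h', h2⟩)
  -- (1) the local version given by the DLR kernel
  have hfdep' : DependsOn f
      (↑Λ ∪ {e : Edge 4 (2 * S + 1) | (e.1 0 - s).val = 2 * S ∨ ((e.1 0 - s).val = ℓ ∧ e.2 ≠ 0)}) :=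
    hfdep.mono (by rw [hΛc]; exact Set.subset_union_left)
  obtain ⟨F₁, hF₁m, hF₁b, hF₁dep, hF₁ae⟩ :=
    WilsonBlockHeatBath.exists_local_condExp_version r.ρ r.continuous β Λ hgeo hfm hfM hfdep'
  -- (2) the local version is a.e. gauge invariant; average it over the gauge group
  have hfint : Integrable f (wilsonMeasure r.ρ β : Measure (GaugeConfig 4 (2 * S + 1) G)) :=
    Integrable.of_bound hfm.aestronglyMeasurable M
      (ae_of_all _ fun U => by rw [Real.norm_eq_abs]; exact hfM U)
  have hinv : ∀ g : Site 4 (2 * S + 1) → G,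
      F₁ ∘ gaugeTransform g =ᵐ[(wilsonMeasure r.ρ β : Measure (GaugeConfig 4 (2 * S + 1) G))] F₁ := by
    intro g
    have hq : Measure.QuasiMeasurePreserving (gaugeTransform g)
        (wilsonMeasure r.ρ β : Measure (GaugeConfig 4 (2 * S + 1) G)) (wilsonMeasure r.ρ β) :=
      (⟨WilsonBlockHeatBath.measurable_gaugeTransform g,
          wilsonMeasure_map_gaugeTransform_holds (d := 4) (L := 2 * S + 1) r.ρ β g⟩ :
        MeasurePreserving (gaugeTransform g) (wilsonMeasure r.ρ β) (wilsonMeasure r.ρ β)).quasiMeasurePreserving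
    have h1 := hq.ae_eq_comp hF₁ae
    have h2 := WilsonBlockHeatBath.condExp_linkSigma_comp_gaugeTransform r.ρ r.continuous β
      ((↑Λ : Set (Edge 4 (2 * S + 1)))ᶜ) g hfint
    rw [WilsonBlockHeatBath.linkSigma_eq_cylinderEvents] at h2
    have hfg : f ∘ gaugeTransform g = f := funext fun U => hfGI g U
    rw [hfg] at h2
    exact h1.trans (h2.symm.trans hF₁ae.symm)
  obtain ⟨F, hFm, hFb, hFGI, hFdep, hFae⟩ :=
    exists_isGaugeInvariant_local_version _ hF₁m hF₁b hF₁dep hinv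
  -- (3) gauge invariance removes the temporal links at offset `2S`; assemble
  refine ⟨F, hFm, hFb, hFGI, dependsOn_spatial_of_isGaugeInvariant s hℓ hℓS hFGI hFdep, ?_⟩
  rw [← hΛcompl]
  exact hFae.trans hF₁ae

end Summit.QuantumFields.YangMills.Theorems.PoincareToGap

end
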